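import Literature.AnabelianGeometry.Anabelioids.InductionStar
import Mathlib.Topology.Algebra.ClopenNhdofOne
import Mathlib.CategoryTheory.Limits.Constructions.EpiMono
import HarnessLib

/-!
# Anabelioids: proof of the named fact `bCat_res_isFiniteEtale_iff` ([GeoAn] Remark 1.2.2.1)

Mochizuki, *The geometry of anabelioids*, Publ. RIMS **40** (2004), §1.2, Remark 1.2.2.1, p. 17
[cite: MochizukiGeoAn2004, Rem. 1.2.2.1 p.17]: "the morphism `B(H) → B(G)` induced by a continuous
homomorphism `φ : H → G` [of profinite groups] is finite étale if and only if `φ` is an injection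
onto an open subgroup of `G`", rendered in `Anabelioids/Basic.lean` as the named fact
`bCat_res_isFiniteEtale_iff` (`IsFiniteEtale P := ∃ S (α : Over S ⥤ B(H)) equivalence, P ≅ Over.star S ⋙ α`
for `P` the restriction functor `ContAction.res _ φ`).  DISCHARGED here:

* (⇐) `S := G ⧸ₐ φ(H)`, `α := fiber ⋙ res(H ≃ φ(H))` (the induction equivalence
  `Anabelioids/Induction*.lean`), and `res φ ≅ Over.star S ⋙ α` from `starFiberIso`
  (`Over.star (G/U) ⋙ fiber ≅ res_U`) and `res` along `φ = (U ↪ G) ∘ (H ≃ U)`.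
* (⇒) INJECTIVITY: every finite continuous `H`-set `T` is (up to isomorphism, `α` essentially
  surjective) some `α(Y → S)`, which embeds by `α(unit)` into `α(star S Y) ≅ res_φ(Y)`
  (monomorphisms of `B(H)` are injective); so `ker φ` acts trivially on every `T`, in particular on
  every `H/K`, `K` open normal — and those separate points (`H` profinite).  OPENNESS: the chain of
  bijections `Hom_{B(H)}(pt, res_φ X) ≅ Hom_{B(H)}(α ⊤, α(star S X)) ≅ Hom_{Over S}(⊤, star S X) ∋ ·`
  turns `G`-maps `S → X` into `φ(H)`-fixed points of `X` and back; `X := S` gives a point `s₀` with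
  `φ(H) ⊆ U₀ := Stab(s₀)`, and `X := G/φ(H)V` (`V ⊆ U₀` open normal) gives `g⁻¹U₀g ⊆ φ(H)V ⊆ U₀`,
  whence (finite index) `φ(H)V = U₀` for all such `V` and `φ(H) = U₀` is open.

Proof-only: no definitions, nothing of the statement file is restated.
-/

noncomputable section

namespace Literature.AnabelianGeometry.Anabelioids

open CategoryTheory CategoryTheory.Limits
open Literature.AlgebraicGeometry.Frobenioids (BCat)
open scoped FintypeCatDiscrete Pointwise Topology
open Induction

section

variable {G H : Type} [Group G] [TopologicalSpace G] [IsTopologicalGroup G] [CompactSpace G]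
  [T2Space G] [TotallyDisconnectedSpace G] [Group H] [TopologicalSpace H] [IsTopologicalGroup H]
  [CompactSpace H] [T2Space H] [TotallyDisconnectedSpace H] (φ : H →ₜ* G)

/-! ### (⇐): an open injection is finite étale -/

omit [T2Space G] [TotallyDisconnectedSpace G] [T2Space H] [TotallyDisconnectedSpace H]
  [IsTopologicalGroup H] in
/-- (⇐) of [GeoAn] Rem. 1.2.2.1: if `φ` is injective with open image `U`, then `res φ` is finite
étale, via `S = G/U`, `α = fiber ⋙ res(H ≃ U)`. [cite: MochizukiGeoAn2004, Rem. 1.2.2.1 p.17] -/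
private theorem isFiniteEtale_res_of_injective_of_isOpen [T2Space G] [HasBinaryProducts (BCat G)]
    (hinj : Function.Injective φ) (hopen : IsOpen (Set.range φ)) :
    IsFiniteEtale (ContAction.res FintypeCat.{0} φ) := by
  classical
  -- the open image
  let U : Subgroup G := φ.toMonoidHom.range
  have hUeq : (U : Set G) = Set.range φ := MonoidHom.coe_range φ.toMonoidHom
  have hU : IsOpen (U : Set G) := by rw [hUeq]; exact hopen
  haveI : Finite (G ⧸ U) := Subgroup.quotient_finite_of_isOpen U hU
  -- `H ≃ₜ* U`
  have hinj' : Function.Injective φ.toMonoidHom := hinj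
  let e₀ : H ≃* U := MonoidHom.ofInjective hinj'
  have he₀ : Continuous e₀ := by
    refine Continuous.subtype_mk ?_ _
    exact φ.continuous
  let eₜ : H ≃ₜ U := Continuous.homeoOfEquivCompactToT2 (f := e₀.toEquiv) he₀
  let e : H ≃ₜ* U :=
    { e₀ with
      continuous_toFun := he₀
      continuous_invFun := eₜ.symm.continuous }
  let e' : H →ₜ* U := e
  have hφ : φ = (inclHom U).comp e' := by
    ext h
    rfl
  -- the functor
  haveI : (ContAction.res FintypeCat.{0} e').IsEquivalence :=
    inferInstanceAs (ContAction.resEquiv FintypeCat.{0} e).functor.IsEquivalence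
  refine ⟨quotObj U hU, fiber U hU ⋙ ContAction.res FintypeCat.{0} e', inferInstance, ⟨?_⟩⟩
  exact (ContAction.resCongr FintypeCat.{0} φ ((inclHom U).comp e') hφ).trans
    ((ContAction.resComp FintypeCat.{0} e' (inclHom U)).trans
      ((Functor.isoWhiskerRight (starFiberIso U hU).symm (ContAction.res FintypeCat.{0} e')).trans
        (Functor.associator _ _ _)))

/-! ### (⇒): tools -/

omit [CompactSpace G] [T2Space G] [TotallyDisconnectedSpace G] [CompactSpace H] [T2Space H]
  [TotallyDisconnectedSpace H] [IsTopologicalGroup G] [IsTopologicalGroup H] in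
/-- `ker φ` acts trivially on every restricted `G`-set `res_φ X`. [folklore] -/
private theorem smul_res_eq (X : BCat G) (h : H) (hh : φ h = 1)
    (t : ((ContAction.res FintypeCat.{0} φ).obj X).obj.V) : h • t = t := by
  change (X.obj.ρ (φ h)).hom t = t
  rw [hh, map_one]
  rfl

omit [CompactSpace G] [T2Space G] [TotallyDisconnectedSpace G] [CompactSpace H] [T2Space H]
  [TotallyDisconnectedSpace H] [IsTopologicalGroup G] [IsTopologicalGroup H] in
/-- Transport of "`h` acts trivially" along an isomorphism of `B(H)`. [folklore] -/
private theorem smul_eq_of_iso {T T' : BCat H} (i : T ≅ T') (h : H)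
    (hT : ∀ t : T.obj.V, h • t = t) (t' : T'.obj.V) : h • t' = t' := by
  have e : i.hom.hom.hom (i.inv.hom.hom t') = t' := by
    have := congrArg (fun ψ : T' ⟶ T' => ψ.hom.hom t') i.inv_hom_id
    simp only [ObjectProperty.FullSubcategory.comp_hom, Action.comp_hom, FintypeCat.comp_apply,
      ObjectProperty.FullSubcategory.id_hom, Action.id_hom, FintypeCat.id_apply] at this
    exact this
  rw [← e, ← hom_smul i.hom.hom h, hT]

omit [CompactSpace G] [T2Space G] [TotallyDisconnectedSpace G] [CompactSpace H] [T2Space H]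
  [TotallyDisconnectedSpace H] [IsTopologicalGroup G] [IsTopologicalGroup H] in
/-- Transport of "`h` acts trivially" along an injective morphism of `B(H)` (backwards). [folklore] -/
private theorem smul_eq_of_injective {T T' : BCat H} (m : T ⟶ T')
    (hm : Function.Injective fun x : T.obj.V => m.hom.hom x) (h : H)
    (hT' : ∀ t' : T'.obj.V, h • t' = t') (t : T.obj.V) : h • t = t := by
  apply hm
  change m.hom.hom (h • t) = m.hom.hom t
  rw [hom_smul m.hom h t, hT']

omit [CompactSpace G] [T2Space G] [TotallyDisconnectedSpace G] [IsTopologicalGroup G] [Group H]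
  [TopologicalSpace H] [IsTopologicalGroup H] [CompactSpace H] [T2Space H]
  [TotallyDisconnectedSpace H] in
/-- The unit `Y → star S Y` of `Over.forget ⊣ Over.star` is a monomorphism (its underlying map
`prod.lift Y.hom (𝟙 _)` is split by `prod.snd`). [folklore] -/
private theorem mono_unit [HasBinaryProducts (BCat G)] (S : BCat G) (Y : Over S) :
    Mono ((Over.forgetAdjStar S).unit.app Y) := by
  haveI : Mono ((Over.forget S).map ((Over.forgetAdjStar S).unit.app Y)) := by
    change Mono ((Over.forgetAdjStar S).unit.app Y).left
    rw [Over.forgetAdjStar_unit_app_left]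
    exact (⟨Limits.prod.snd, Limits.prod.lift_snd _ _⟩ :
      SplitMono (Limits.prod.lift Y.hom (𝟙 ((Over.forget S).obj Y)))).mono
  exact (Over.forget S).mono_of_mono_map this

/-! ### (⇒): injectivity -/

omit [T2Space G] [TotallyDisconnectedSpace G] [CompactSpace G] [IsTopologicalGroup G] [T2Space H] in
/-- (⇒), first half: finite étale ⇒ `φ` injective. [cite: MochizukiGeoAn2004, Rem. 1.2.2.1 p.17] -/
private theorem injective_of_isFiniteEtale [HasBinaryProducts (BCat G)]
    (hfe : IsFiniteEtale (ContAction.res FintypeCat.{0} φ)) : Function.Injective φ := by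
  classical
  obtain ⟨S, α, hα, ⟨ι⟩⟩ := hfe
  -- every `h ∈ ker φ` acts trivially on every finite continuous `H`-set
  have key : ∀ h : H, φ h = 1 → ∀ (T : BCat H) (t : T.obj.V), h • t = t := by
    intro h hh T
    -- `T ≅ α Y`, `α Y ↪ α (star S Y.left) ≅ res_φ Y.left`
    let Y : Over S := α.objPreimage T
    have h1 : ∀ t, h • t = t :=
      smul_eq_of_iso (ι.app Y.left) h (smul_res_eq φ Y.left h hh)
    -- along the mono `α.map unit`
    haveI := mono_unit S Y
    haveI : Mono (α.map ((Over.forgetAdjStar S).unit.app Y)) := inferInstance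
    have h2 : ∀ t : (α.obj Y).obj.V, h • t = t :=
      smul_eq_of_injective (α.map ((Over.forgetAdjStar S).unit.app Y))
        (injective_of_mono _) h h1
    exact smul_eq_of_iso (α.objObjPreimageIso T) h h2
  -- points are separated by open normal subgroups
  rw [injective_iff_map_eq_one]
  intro h hh
  by_contra hne
  obtain ⟨K, hK⟩ := ProfiniteGrp.exist_openNormalSubgroup_sub_open_nhds_of_one
    (isOpen_compl_singleton (x := h)) (by simpa using fun e => hne e.symm)
  haveI : Finite (H ⧸ K.toSubgroup) := Subgroup.quotient_finite_of_isOpen K.toSubgroup K.isOpen'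
  have := key h hh (quotObj K.toSubgroup K.isOpen') (basePt K.toSubgroup K.isOpen')
  change ((((h * 1 : H)) : H ⧸ K.toSubgroup) : (H ⧸ₐ K.toSubgroup).V) = (((1 : H) : H ⧸ K.toSubgroup) : _) at this
  have hmem : h ∈ K.toSubgroup := by
    have e : ((h : H) : H ⧸ K.toSubgroup) = ((1 : H) : H ⧸ K.toSubgroup) := by
      rw [mul_one] at this; exact this
    rw [QuotientGroup.eq, mul_one, inv_mem_iff] at e
    exact e
  exact hK hmem rfl

/-! ### (⇒): openness of the image -/

omit [T2Space G] [TotallyDisconnectedSpace G] [CompactSpace G] [CompactSpace H] [T2Space H]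
  [TotallyDisconnectedSpace H] [IsTopologicalGroup G] in
/-- From a `G`-map `S → X` to a `φ(H)`-fixed point of `X` (through `Hom(⊤, star S X)`, `α`, and
`res_φ X ≅ α(star S X)`). [folklore] -/
private theorem exists_fixed_of_hom [HasBinaryProducts (BCat G)] (S : BCat G)
    (α : Over S ⥤ BCat H) [α.IsEquivalence]
    (ι : ContAction.res FintypeCat.{0} φ ≅ Over.star S ⋙ α) (X : BCat G) (m : S ⟶ X) :
    ∃ x : X.obj.V, ∀ h : H, φ h • x = x := by
  -- the section `⊤ → star S X` over `S`
  let n : Over.mk (𝟙 S) ⟶ (Over.star S).obj X := (Over.forgetAdjStar S).homEquiv _ X m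
  have hT : IsTerminal (α.obj (Over.mk (𝟙 S))) := Over.mkIdTerminal.isTerminalObj α _
  let f : (ptObj : BCat H) ⟶ (ContAction.res FintypeCat.{0} φ).obj X :=
    hT.from ptObj ≫ α.map n ≫ ι.inv.app X
  refine ⟨f.hom.hom PUnit.unit, fun h => ?_⟩
  have := smul_hom_pt f h PUnit.unit
  exact this

omit [T2Space G] [TotallyDisconnectedSpace G] [CompactSpace G] [CompactSpace H] [T2Space H]
  [TotallyDisconnectedSpace H] [IsTopologicalGroup G] in
/-- From a `φ(H)`-fixed point of `X` to a `G`-map `S → X` (backwards through the same chain; `α` is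
full). [folklore] -/
private theorem nonempty_hom_of_fixed [HasBinaryProducts (BCat G)] (S : BCat G)
    (α : Over S ⥤ BCat H) [α.IsEquivalence]
    (ι : ContAction.res FintypeCat.{0} φ ≅ Over.star S ⋙ α) (X : BCat G) (x : X.obj.V)
    (hx : ∀ h : H, φ h • x = x) : Nonempty (S ⟶ X) := by
  have hT : IsTerminal (α.obj (Over.mk (𝟙 S))) := Over.mkIdTerminal.isTerminalObj α _
  let f : (ptObj : BCat H) ⟶ (ContAction.res FintypeCat.{0} φ).obj X :=
    ofFixedPoint ((ContAction.res FintypeCat.{0} φ).obj X) x (fun h => hx h)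
  let g : α.obj (Over.mk (𝟙 S)) ⟶ α.obj ((Over.star S).obj X) :=
    isTerminalPt.from _ ≫ f ≫ ι.hom.app X
  let n : Over.mk (𝟙 S) ⟶ (Over.star S).obj X := α.preimage g
  exact ⟨n.left ≫ Limits.prod.snd⟩

omit [TopologicalSpace G] [IsTopologicalGroup G] [CompactSpace G] [T2Space G]
  [TotallyDisconnectedSpace G] in
/-- A subgroup contained between a conjugate of an open subgroup `U₀` of finite index and `U₀`
itself is `U₀`. [folklore] -/
private theorem eq_of_conj_le_le (U₀ W : Subgroup G) [Finite (G ⧸ U₀)] (g : G)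
    (h1 : U₀.map (MulAut.conj g).toMonoidHom ≤ W) (h2 : W ≤ U₀) : W = U₀ := by
  have hidx : (U₀.map (MulAut.conj g).toMonoidHom).index = U₀.index :=
    Subgroup.index_map_of_bijective (MulAut.conj g).bijective U₀
  have hne : U₀.index ≠ 0 := Subgroup.index_ne_zero_of_finite
  haveI : (U₀.map (MulAut.conj g).toMonoidHom).FiniteIndex := ⟨by rw [hidx]; exact hne⟩
  haveI : W.FiniteIndex := Subgroup.finiteIndex_of_le h1
  -- indices: index W divides both ways
  have hW : W.index = U₀.index := by
    apply le_antisymm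
    · have := Subgroup.index_antitone h1
      rw [hidx] at this
      exact this
    · exact Subgroup.index_antitone h2
  have hrel := Subgroup.relIndex_mul_index h2
  rw [hW] at hrel
  have h1' : W.relIndex U₀ = 1 := by
    have : W.relIndex U₀ * U₀.index = 1 * U₀.index := by rw [hrel, one_mul]
    exact Nat.eq_of_mul_eq_mul_right (Nat.pos_of_ne_zero hne) this
  exact le_antisymm h2 (Subgroup.relIndex_eq_one.mp h1')

omit [TotallyDisconnectedSpace H] [T2Space H] in
/-- (⇒), second half: finite étale ⇒ `φ(H)` open. [cite: MochizukiGeoAn2004, Rem. 1.2.2.1 p.17] -/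
private theorem isOpen_range_of_isFiniteEtale [HasBinaryProducts (BCat G)]
    (hfe : IsFiniteEtale (ContAction.res FintypeCat.{0} φ)) : IsOpen (Set.range φ) := by
  classical
  obtain ⟨S, α, hα, ⟨ι⟩⟩ := hfe
  let R : Subgroup G := φ.toMonoidHom.range
  have hReq : (R : Set G) = Set.range φ := MonoidHom.coe_range φ.toMonoidHom
  -- a point of `S` fixed by `φ(H)`
  obtain ⟨s₀, hs₀⟩ := exists_fixed_of_hom φ S α ι S (𝟙 S)
  let U₀ : Subgroup G := MulAction.stabilizer G s₀
  have hU₀ : IsOpen (U₀ : Set G) := (isContinuous_iff S.obj).mp S.property s₀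
  haveI : Finite (G ⧸ U₀) := Subgroup.quotient_finite_of_isOpen U₀ hU₀
  have hRU₀ : R ≤ U₀ := by
    rintro _ ⟨h, rfl⟩
    exact hs₀ h
  -- for every open normal `V ≤ U₀`: `φ(H) ⊔ V = U₀`
  have step : ∀ V : OpenNormalSubgroup G, V.toSubgroup ≤ U₀ → R ⊔ V.toSubgroup = U₀ := by
    intro V hV
    let W : Subgroup G := R ⊔ V.toSubgroup
    have hWle : W ≤ U₀ := sup_le hRU₀ hV
    have hWopen : IsOpen (W : Set G) :=
      Subgroup.isOpen_mono (le_sup_right : V.toSubgroup ≤ W) V.isOpen'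
    haveI : Finite (G ⧸ W) := Subgroup.quotient_finite_of_isOpen W hWopen
    -- `eW` is fixed by `φ(H)`
    have hfix : ∀ h : H, φ h • basePt W hWopen = basePt W hWopen := by
      intro h
      change ((((φ h * 1 : G)) : G ⧸ W) : (G ⧸ₐ W).V) = (((1 : G) : G ⧸ W) : _)
      have : ((φ h * 1 : G) : G ⧸ W) = ((1 : G) : G ⧸ W) := by
        rw [mul_one, QuotientGroup.eq, mul_one, inv_mem_iff]
        exact le_sup_left (b := V.toSubgroup) ⟨h, rfl⟩
      exact this
    obtain ⟨m⟩ := nonempty_hom_of_fixed φ S α ι (quotObj W hWopen) (basePt W hWopen) hfix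
    -- `Stab(s₀) ≤ Stab(m s₀) = g W g⁻¹`
    obtain ⟨g, hg⟩ := QuotientGroup.mk_surjective (m.hom.hom s₀ : G ⧸ W)
    have hconj : U₀.map (MulAut.conj g⁻¹).toMonoidHom ≤ W := by
      rintro _ ⟨x, hx, rfl⟩
      change g⁻¹ * x * g⁻¹⁻¹ ∈ W
      rw [inv_inv]
      have hx' : x • m.hom.hom s₀ = m.hom.hom s₀ := by
        rw [← hom_smul m.hom x s₀]
        exact congrArg _ hx
      have hx'' : (((x * g : G)) : G ⧸ W) = ((g : G) : G ⧸ W) := by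
        have e := hx'
        rw [← hg] at e
        exact e
      rw [QuotientGroup.eq] at hx''
      -- hx'' : (x * g)⁻¹ * g ∈ W
      have : ((x * g)⁻¹ * g)⁻¹ ∈ W := W.inv_mem hx''
      simpa [mul_inv_rev, mul_assoc] using this
    exact eq_of_conj_le_le U₀ W g⁻¹ hconj hWle
  -- `φ(H)` is closed, hence equal to `U₀`
  have hclosed : IsClosed (R : Set G) := by
    rw [hReq]
    exact (isCompact_range φ.continuous).isClosed
  have hRU : (R : Set G) = (U₀ : Set G) := by
    apply Set.Subset.antisymm (fun x hx => hRU₀ hx)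
    intro x hxU
    by_contra hxR
    -- an open normal `V ≤ U₀` with `x ∉ R V`
    have hN : IsOpen ({y : G | x * y ∈ (R : Set G)ᶜ} ∩ (U₀ : Set G)) :=
      ((hclosed.isOpen_compl).preimage (continuous_const_mul x)).inter hU₀
    obtain ⟨V, hV⟩ := ProfiniteGrp.exist_openNormalSubgroup_sub_open_nhds_of_one hN
      ⟨by simpa using hxR, U₀.one_mem⟩
    have hVU : V.toSubgroup ≤ U₀ := fun y hy => (hV hy).2
    have hx : x ∈ R ⊔ V.toSubgroup := by rw [step V hVU]; exact hxU
    rw [← SetLike.mem_coe, Subgroup.mul_normal] at hx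
    obtain ⟨r, hr, v, hv, hrv⟩ := hx
    have hv' : x * v⁻¹ ∈ (R : Set G)ᶜ := (hV (V.toSubgroup.inv_mem hv)).1
    apply hv'
    rw [← hrv, mul_inv_cancel_right]
    exact hr
  rw [← hReq, hRU]
  exact hU₀

end

/-- NAMED FACT `bCat_res_isFiniteEtale_iff` = [GeoAn] Remark 1.2.2.1, PROVED: for a continuous
homomorphism `φ : H → G` of profinite groups, restriction `B(G) → B(H)` is finite étale iff `φ` is
injective with open image — (⇐) by the induction equivalence `B(G)_{G/φ(H)} ≌ B(φ(H)) ≌ B(H)`,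
(⇒) by transporting trivial actions and fixed points through the equivalence.
[cite: MochizukiGeoAn2004, Rem. 1.2.2.1 p.17] -/
theorem bCat_res_isFiniteEtale_iff_holds : bCat_res_isFiniteEtale_iff := by
  intro G H _ _ _ _ _ _ _ _ _ _ _ _ φ _
  constructor
  · intro hfe
    exact ⟨injective_of_isFiniteEtale φ hfe, isOpen_range_of_isFiniteEtale φ hfe⟩
  · rintro ⟨hinj, hopen⟩
    exact isFiniteEtale_res_of_injective_of_isOpen φ hinj hopen

end Literature.AnabelianGeometry.Anabelioids

end
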